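import Summits.CriticalPhenomena.SAWScalingLimit.Theorems.SAWTotalPositivityCriticalBubbleBoundKestenDefs

/-!
# Line `kesten-product-renewal-dictionary` (crux stmt-CriticalPhenomena-7117): the two-bridge cut — DEFINITIONS

Objects of the LEXICOGRAPHIC TWO-BRIDGE CUT of rooted critical polygons (stub A / `PolygonCut` of the line;
lead seat c1), on top of the line's shared `…KestenDefs.lean` (`Bridge`, `eUp`, `BridgePair`, …). An `n`-step
self-avoiding walk `ω : 0 → e₀` of `ℤ²` (`ω ∈ Zd.sawFun 2 n e₀`, `n ≥ 2`) closed up by the root edge `{e₀, 0}`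
is a self-avoiding polygon with `n + 1` vertices, read here as the periodic vertex function `cyc n ω`.
With `B` its lexicographically lowest vertex (index `baseIdx`) and `A` its highest (index `apexIdx`, the top
vertex of the rightmost column), the cut consists of the two arcs from `B` to `A`:
`W₁ = (B - e₀) → B → B + e₀ → ⋯ → A` (`fstWalk`, leaving `B` horizontally, `arcLen + 1` steps) and `W₂`
with `W₂ + e₁ = (B - e₀ + e₁) → B + e₁ → ⋯ → A` (`sndWalk`, `coLen` steps), both translated by
`-(B - e₀)` (`shiftVec`); `rootPos` records where on the polygon, walked from `B`, the root edge sits.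

This file only DEFINES these objects (all proofs — that `W₁`, `W₂` are bridges meeting only at the apex,
injectivity of `ω ↦ (W₁, W₂, rootPos)`, and the summation to `G_{x_c}(0,e₀) ≤ x_c + μ² Σ_h M₂(h)` — are in the
proof files `…KestenCutCycle/Walks/Map/Sum.lean`). Sources: the line card
`Cruxes/CriticalBubbleBound/Lines/kesten-product-renewal-dictionary.md` (stub A); N. Madras, G. Slade,
*The Self-Avoiding Walk* (1993), §1.1 and Definition 3.2.1 (walks and polygons), Definition 1.2.4 (bridges).
-/

noncomputable section

open Literature.Probability.LatticeModels
open Literature.Probability.RandomPlanarGeometry Literature.Probability.RandomPlanarGeometry.SAW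
open scoped BigOperators
open Summit.CriticalPhenomena.SAWScalingLimit.Theorems.CriticalBubbleBound.Negative (e₀ adj_zero_e₀)

namespace Summit.CriticalPhenomena.SAWScalingLimit.Theorems.CriticalBubbleBound.Kesten.Cut

variable {n : ℕ} {ω : ℕ → Site 2}

/-! ## The rooted polygon as a periodic vertex function; its extreme vertices -/

/-- The cyclic vertex function of the rooted polygon of `ω`: `cyc n ω k = ω (k mod (n+1))` (period `n + 1`;
the step from index `n` to index `n + 1 ≡ 0` is the root edge `e₀ → 0`). [cite: MadrasSlade1993, Definition 3.2.1] -/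
def cyc (n : ℕ) (ω : ℕ → Site 2) (k : ℕ) : Site 2 := ω (k % (n + 1))

/-- The lexicographic key (first coordinate, then second) of the `i`-th vertex. [folklore] -/
def key (ω : ℕ → Site 2) (i : ℕ) : ℤ ×ₗ ℤ := toLex (ω i 0, ω i 1)

/-- An index in `[0, n]` of the lexicographically LOWEST vertex `B` of `ω` (a minimiser of `key` over
`Finset.range (n+1)`, chosen once and for all). [folklore] -/
def baseIdx (n : ℕ) (ω : ℕ → Site 2) : ℕ :=
  Classical.choose (Finset.exists_min_image (Finset.range (n + 1)) (key ω) ⟨0, by simp⟩)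

/-- An index in `[0, n]` of the lexicographically HIGHEST vertex `A` of `ω` (the top vertex of the rightmost
column). [folklore] -/
def apexIdx (n : ℕ) (ω : ℕ → Site 2) : ℕ :=
  Classical.choose (Finset.exists_max_image (Finset.range (n + 1)) (key ω) ⟨0, by simp⟩)

/-- The lowest vertex `B = ω (baseIdx n ω)`. [folklore] -/
def base (n : ℕ) (ω : ℕ → Site 2) : Site 2 := ω (baseIdx n ω)

/-- The highest vertex `A = ω (apexIdx n ω)`. [folklore] -/
def apex (n : ℕ) (ω : ℕ → Site 2) : Site 2 := ω (apexIdx n ω)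

/-! ## Walking around the polygon from the lowest vertex -/

/-- The direction flag: `true` iff the cyclic successor of `B` is `B + e₀`. [folklore] -/
def dir (n : ℕ) (ω : ℕ → Site 2) : Bool := decide (cyc n ω (baseIdx n ω + 1) = base n ω + e₀)

/-- The index offset of `j` steps in direction `s` (`j ≤ n + 1`; `j` backward steps are `n + 1 - j` forward
steps modulo the period). [folklore] -/
def off (n : ℕ) (s : Bool) (j : ℕ) : ℕ := if s then j else n + 1 - j

/-- The index reached after `j` steps from `baseIdx` in direction `s`. [folklore] -/
def pos (n : ℕ) (ω : ℕ → Site 2) (s : Bool) (j : ℕ) : ℕ := baseIdx n ω + off n s j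

/-- `ℓ` — the number of steps from `B` to `A` in direction `dir`. [folklore] -/
def arcLen (n : ℕ) (ω : ℕ → Site 2) : ℕ :=
  if dir n ω then (apexIdx n ω + (n + 1) - baseIdx n ω) % (n + 1)
  else (baseIdx n ω + (n + 1) - apexIdx n ω) % (n + 1)

/-- `ℓ' = n + 1 - ℓ` — the number of steps from `B` to `A` in the other direction. [folklore] -/
def coLen (n : ℕ) (ω : ℕ → Site 2) : ℕ := n + 1 - arcLen n ω

/-! ## The two walks of the cut and the root position -/

/-- The translation vector `T = B - e₀` (the start of `W₁` before translating to the origin). [folklore] -/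
def shiftVec (n : ℕ) (ω : ℕ → Site 2) : Site 2 := base n ω - e₀

/-- `W₁ = (B - e₀) → B → B + e₀ → ⋯ → A`, translated by `-T`: an `(ℓ+1)`-step walk from `0`, frozen after.
[folklore] -/
def fstWalk (n : ℕ) (ω : ℕ → Site 2) (k : ℕ) : Site 2 :=
  if k = 0 then 0 else cyc n ω (pos n ω (dir n ω) (min k (arcLen n ω + 1) - 1)) - shiftVec n ω

/-- `W₂`, where `W₂ + e₁ = (B - e₀ + e₁) → B + e₁ → ⋯ → A` is the other arc, translated by `-T`: an
`ℓ'`-step walk from `0`, frozen after. [folklore] -/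
def sndWalk (n : ℕ) (ω : ℕ → Site 2) (k : ℕ) : Site 2 :=
  if k = 0 then 0 else cyc n ω (pos n ω (!dir n ω) (min k (coLen n ω))) - shiftVec n ω - eUp

/-- The polygon vertex at chain position `j` (walking from `B` in direction `dir`). [folklore] -/
def vtx (n : ℕ) (ω : ℕ → Site 2) (j : ℕ) : Site 2 := cyc n ω (pos n ω (dir n ω) j)

/-- The SHAPE of the polygon read off two walks alone (no translation, no direction): chain position `j ≤ ℓ`
is `W₁ (j+1)`, position `ℓ < j ≤ n` is `W₂ (n+1-j) + e₁`, position `n + 1` is position `0`. [folklore] -/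
def shape (W₁ W₂ : ℕ → Site 2) (ℓ n j : ℕ) : Site 2 :=
  if j ≤ ℓ then W₁ (j + 1) else if j ≤ n then W₂ (n + 1 - j) + eUp else W₁ 1

/-- `m` — the chain position at which the walk around the polygon enters the root edge `{e₀, 0}`:
`n - baseIdx` in direction `true` (the edge is then traversed `e₀ → 0`), `baseIdx` in direction `false`
(traversed `0 → e₀`). [folklore] -/
def rootPos (n : ℕ) (ω : ℕ → Site 2) : ℕ := if dir n ω then n - baseIdx n ω else baseIdx n ω

/-- Unfolding `cyc` (registered infrastructure sub-goal of the crux item carried by this definitions file).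
[folklore] -/
theorem cyc_apply : ∀ (n : ℕ) (ω : ℕ → Site 2) (k : ℕ), cyc n ω k = ω (k % (n + 1)) := fun _ _ _ => rfl

end Summit.CriticalPhenomena.SAWScalingLimit.Theorems.CriticalBubbleBound.Kesten.Cut

end
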